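import Summits.BirchSwinnertonDyer.Rank1Residual.X10.SelmerStructureSum
import HarnessLib

/-!
# The RESIDUAL Selmer structure and the N2 parity laws (P), (C1) over KMR §3
# (cell `b2b-bsdres`, unit `b2b-bsdres-x10` = N2 class lead, GEN 30; TOOL — theorems and one
# definition with body over ABSTRACT localisation data; no named fact; nothing booked; file 2 of 4)

HONEST FRAMING (run/shared/lean/b2b/bsd-rank1-residual/, verbatim in every file): the goal of the
cell is to DELETE the COMBINATION-SHAPED residual classes of the Birch–Swinnerton-Dyer formula for
ALL analytic-rank `≤ 1` elliptic curves over `ℚ` — "full BSD formula for every rank `≤ 1` curve in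
class `C`" assembled STRICTLY from published theorems — so that the rank-`≤ 1` remainder becomes
exactly the CONSTRUCTION-SHAPED classes, which are TYPED (missing-input `Prop`s), NOT attempted.
This is not "finishing BSD". Class X10b (= N2) keeps its label CONSTRUCTION-SHAPED (NEEDS `X_A3`,
referee R82.3 / RESIDUAL-MAP §I N2); this file is a TOOL; no mark / label / tier / count moves.

## What

For a quadratic Selmer structure `𝒮` of a global metabolic structure `𝓆` (Klagsbrun–Mazur–Rubin
2013 Def. 3.3 / 3.8, tree file `Literature/NumberTheory/EllipticCurves/QuadraticSelmerStructure.lean`,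
Thm. 3.9 PROVED there) and a finite set of places `P ⊇ S₀` (the instance: the places above `p`):

* §3 the **RESIDUAL structure** `residual 𝒮 P hP` (`W v` on `P`, the unramified `Λ v` off `P`),
  its Selmer group `H¹_{𝒮⁰}` (`mem_residual_selmerGroup_iff`), `selmerGroup_residual_eq_of_agree`
  (two structures agreeing on `P` have ONE residual group), **(X) abstract**
  `selmerGroup_eq_residual_of_agree_of_unramified_off` (a structure agreeing with `𝒮` on `P` and
  unramified off `P` has Selmer group `H¹_{𝒮⁰}`; with the NO-GO below: **(C2)**
  `selmerGroup_ne_bot_of_agree_of_unramified_off_of_odd`), and **(P)**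
  `finrank_selmerGroup_sub_residual_modEq`: `dim H¹_𝒮 − dim H¹_{𝒮⁰} ≡ ∑_{v ∈ S \ P} dim W_v/(W_v ∩ Λ_v)
  (mod 2)` (Mazur–Rubin 2007 Thm. 1.4 = KMR Thm. 3.9 with `𝒮' = 𝒮⁰`); with LOCAL TERMS (`W_v = Λ_v`
  off a finite `T ⊆ S \ P`, `dim W_v/(W_v ∩ Λ_v) = 1` on `T`) `even_finrank_add_finrank_residual_add_card`:
  `dim H¹_𝒮 + dim H¹_{𝒮⁰} + #T` is even; the NO-GO `residual_selmerGroup_ne_bot_of_odd`; and over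
  `𝔽_p` in the order currency `#H¹_𝒮 = p^s`: `even_add_add_card_of_natCard_eq_pow`,
  `residual_selmerGroup_ne_bot_of_odd_natCard`.
* §4 **(C1)** `even_finrank_add_card_add_finrank_add_card`: two structures agreeing on `P` satisfy
  `dim H¹_{𝒮₁} + #T₁ ≡ dim H¹_{𝒮₂} + #T₂ (mod 2)`.
The generator test (G) is file 3 (`X10/ResidualSelmerGeneratorTest.lean`); MR07 Prop. 1.3 (i) is
file 1 (`X10/SelmerStructureSum.lean`); KMR Lemma 3.4 (the instance needs only BILINEAR data when
`2 ≠ 0`) is file 4 (`X10/TateQuadraticFormsOdd.lean`). Everything is fact-free algebra above Thm. 3.9.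

## The intended instance (NOT built here; P-SPEC (I1)–(I6); it is where the named facts live)

`K = ℚ`, `p` odd (`= 3`), `T = E[p]`, `F = 𝔽_p`, `ι` = finite places (for odd `p`, `H¹(ℝ, T) = 0`),
`H = H¹(ℚ, E[p])`, `L v = H¹(ℚ_v, E[p])`, `loc v` = restriction, `Λ v = H¹_ur(ℚ_v, E[p])`,
`S₀ = {p}`, `𝓆 = (½⟨x, x⟩_v)_v` THE unique global metabolic structure on `E[p]`
[Klagsbrun–Mazur–Rubin 2013, Lemma 3.4 and §5 ¶1; Thm. 3.1 = Milne *ADT* I.2.3/I.2.6 + the sum of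
local invariants; `Λ v` is Lagrangian at EVERY `v ∤ p`, ramified or not: NSW (7.2.15)],
`𝒮 = 𝓔` the Kummer structure (`W v = im(E(ℚ_v)/p → H¹(ℚ_v, E[p]))`, Lagrangian: KMR Lemma 5.3 /
MR07 Prop. 2.1 "Tate's local duality shows that 𝓔 is self-dual"), `P = {p}`, so
`H¹_𝒮 = Sel_p(E/ℚ)` and `H¹_{𝒮⁰} = S⁰(E)`; `IsSelfDualAt S` = Poitou–Tate (Milne I.4.10; the
tree's named fact `poitouTate_sum_localTatePairing_eq_zero` is the inclusion); the local term at
`ℓ ≠ p`: `dim W_ℓ/(W_ℓ ∩ H¹_ur) = [p ∣ c_ℓ(E)]` ((I6): n1011 row T-URTAM gives `W_ℓ = H¹_ur` when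
`p ∤ c_ℓ`; `= 1` when `p ∣ c_ℓ` because `Φ_ℓ(k)[p]` is cyclic). With that instance §3 is (P) for
the 313 N2 cells (25 NOGO-parity verdicts: `dim S⁰` odd ⟹ `S⁰ ≠ 0` ⟹ by (X) no Tamagawa-`3`-free
good-at-`3` congruent UNIT curve exists), §4 is (C1) (census 410/410 + 229/229, memo §2) and §5
decides `S⁰(118810q1) = 0` from its twin `118810j1` (generator `(187/9, 3262/27)` hits the node
mod `5`). Nothing of that is claimed here: this file is the algebra above Thm. 3.9, once.

## References

* [KlagsbrunMazurRubin2013] Z. Klagsbrun, B. Mazur, K. Rubin, *Disparity in Selmer ranks of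
  quadratic twists of elliptic curves*, Ann. of Math. 178 (2013), §2 (Lemma 2.2, Prop. 2.4), §3
  (Thm. 3.1, Def. 3.3, Lemma 3.4, Def. 3.8, Thm. 3.9), §5 (Lemma 5.3) — arXiv:1111.2321, read.
* [MazurRubin2007] B. Mazur, K. Rubin, *Finding large Selmer rank via an arithmetic theory of local
  constants*, Ann. of Math. 166 (2007), Def. 1.2, Prop. 1.3, Thm. 1.4, Prop. 2.1 —
  arXiv:math/0512085 pp. 5–6, read (verbatim in HOME/class-closure/N2/TRIVIAL-ROADS-x10g27.md §1).
* HOME/class-closure/N2/{TRIVIAL-ROADS-x10g27.md §§1–3, §9; P-SPEC-x10g29.md}; HOME/X10-AUDIT.md §§33–36.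
-/

set_option autoImplicit false

noncomputable section

open Module QuadraticMap Literature.LinearAlgebra.QuadraticForm Literature.NumberTheory.EllipticCurves
open Summit.BirchSwinnertonDyer.Rank1Residual.X10.SelmerStructureSum

namespace Summit.BirchSwinnertonDyer.Rank1Residual.X10.ResidualSelmerParity

universe u v w x

/-! ### §3. The RESIDUAL structure `𝒮⁰` and the parity law (P) -/

section Residual

variable {F : Type u} [Field F] {ι : Type v} [DecidableEq ι] {H : Type w} [AddCommGroup H]
  [Module F H] {L : ι → Type x} [∀ v, AddCommGroup (L v)] [∀ v, Module F (L v)]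
  {loc : ∀ v, H →ₗ[F] L v} {Λ : ∀ v, Submodule F (L v)} {S₀ : Finset ι}
  {𝓆 : GlobalMetabolicStructure loc Λ S₀}

/-- The **residual Selmer structure** `𝒮⁰ = residual 𝒮 P` of a quadratic Selmer structure `𝒮`
relative to a finite set of places `P ⊇ S₀`: the local condition of `𝒮` at the places of `P` and
the unramified subspace `Λ v` at every other place (Lagrangian off `S₀` by (ii′) of KMR Def. 3.3;
KMR Def. 3.8 through `ofLagrangians`). THE INSTANCE (module docstring): `𝒮 = 𝓔` the Kummer
structure of `E[p]`, `P` = the places above `p`; then `H¹_{𝒮⁰}(ℚ, E[p]) = S⁰(E)` of the N2 memo —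
Mazur–Rubin 2007's structure `𝓖` with `H¹_𝓖(K_v) = H¹_ur` for `v ∤ p`, `= H¹_𝓕(K_v)` for `v ∣ p`.
[cite: KlagsbrunMazurRubin2013, Def. 3.8] [cite: MazurRubin2007, Def. 1.2 and Thm. 1.4] -/
def residual (𝒮 : QuadraticSelmerStructure 𝓆) (P : Finset ι) (hP : S₀ ⊆ P) :
    QuadraticSelmerStructure 𝓆 :=
  QuadraticSelmerStructure.ofLagrangians P hP 𝒮.W fun v _ => 𝒮.isLagrangian v

variable (𝒮 : QuadraticSelmerStructure 𝓆) {P : Finset ι} (hP : S₀ ⊆ P)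

/-- `Σ_{𝒮⁰} = P`. [cite: KlagsbrunMazurRubin2013, Def. 3.8] -/
@[simp] theorem residual_places : (residual 𝒮 P hP).places = P := rfl

/-- On `P` the residual condition is that of `𝒮`. [cite: KlagsbrunMazurRubin2013, Def. 3.8] -/
@[simp] theorem residual_W_of_mem {v : ι} (hv : v ∈ P) : (residual 𝒮 P hP).W v = 𝒮.W v :=
  QuadraticSelmerStructure.ofLagrangians_W_of_mem hP _ hv

/-- Off `P` the residual condition is the unramified one. [cite: KlagsbrunMazurRubin2013, Def. 3.8] -/
@[simp] theorem residual_W_of_not_mem {v : ι} (hv : v ∉ P) : (residual 𝒮 P hP).W v = Λ v :=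
  QuadraticSelmerStructure.ofLagrangians_W_of_not_mem hP _ hv

/-- Membership in the residual Selmer group `H¹_{𝒮⁰} = {c : loc_v c ∈ W_v (v ∈ P), loc_v c ∈ Λ_v
(v ∉ P)}` (the N2 memo's `S⁰(E) = {ξ : ξ_ℓ ∈ H¹_ur ∀ ℓ ≠ 3, ξ₃ ∈ 𝓛₃(E)}`).
[cite: MazurRubin2007, Def. 1.2] -/
theorem mem_residual_selmerGroup_iff (c : H) :
    c ∈ (residual 𝒮 P hP).selmerGroup ↔
      (∀ v ∈ P, loc v c ∈ 𝒮.W v) ∧ ∀ v, v ∉ P → loc v c ∈ Λ v := by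
  rw [QuadraticSelmerStructure.mem_selmerGroup_iff]
  refine ⟨fun h => ⟨fun v hv => ?_, fun v hv => ?_⟩, fun h v => ?_⟩
  · simpa only [residual_W_of_mem 𝒮 hP hv] using h v
  · simpa only [residual_W_of_not_mem 𝒮 hP hv] using h v
  · by_cases hv : v ∈ P
    · simpa only [residual_W_of_mem 𝒮 hP hv] using h.1 v hv
    · simpa only [residual_W_of_not_mem 𝒮 hP hv] using h.2 v hv

/-- Two Selmer structures that AGREE ON `P` — in the weak, GLOBAL sense that a global class
satisfies one local condition at `v ∈ P` iff it satisfies the other (the currency of the tree's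
Selmer local kernels `selmerLocalKer` and of the named fact `hMR`) — have the same residual Selmer
group (the instance: two `p`-congruent curves both good above `p` agree at `v ∣ p` by Mazur–Rubin
2015 Thm. 3.1 (iv)(b), hence ONE group `S⁰`; TRIVIAL-ROADS memo (X)). [cite: MazurRubin2007, Def. 1.2] -/
theorem selmerGroup_residual_eq_of_agree (𝒮₁ 𝒮₂ : QuadraticSelmerStructure 𝓆)
    (hagree : ∀ v ∈ P, ∀ c : H, loc v c ∈ 𝒮₁.W v ↔ loc v c ∈ 𝒮₂.W v) :
    (residual 𝒮₁ P hP).selmerGroup = (residual 𝒮₂ P hP).selmerGroup := by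
  ext c
  rw [mem_residual_selmerGroup_iff, mem_residual_selmerGroup_iff]
  refine ⟨fun h => ⟨fun v hv => ?_, h.2⟩, fun h => ⟨fun v hv => ?_, h.2⟩⟩
  · exact (hagree v hv c).mp (h.1 v hv)
  · exact (hagree v hv c).mpr (h.1 v hv)

/-- A Selmer structure that is UNRAMIFIED OFF `P` is its own residual structure, on Selmer groups
(weak GLOBAL sense: a global class satisfies `W v` iff it is unramified at `v`, for `v ∉ P` — the
currency of (L1), n1011 row T-URTAM FILE 1; the LOCAL equality `W v = Λ v` of FILE 2 implies it).
The instance: a Tamagawa-`p`-free curve `A` good at `p`, `T_A = ∅`: `Sel_p(A) = S⁰(A)` — TRIVIAL-ROADS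
memo §1 (X) with `A = E`. [cite: MazurRubin2007, Def. 1.2] -/
theorem residual_selmerGroup_eq_self_of_unramified_off
    (hoff : ∀ v, v ∉ P → ∀ c : H, loc v c ∈ 𝒮.W v ↔ loc v c ∈ Λ v) :
    (residual 𝒮 P hP).selmerGroup = 𝒮.selmerGroup := by
  ext c
  rw [mem_residual_selmerGroup_iff, QuadraticSelmerStructure.mem_selmerGroup_iff]
  refine ⟨fun h v => ?_, fun h => ⟨fun v _ => h v, fun v hv => ?_⟩⟩
  · by_cases hv : v ∈ P
    · exact h.1 v hv
    · exact (hoff v hv c).mpr (h.2 v hv)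
  · exact (hoff v hv c).mp (h v)

/-- **(X) abstract — a Tamagawa-free companion's Selmer group IS the residual group.** If `𝒮_A`
agrees with `𝒮_E` on `P` and is unramified off `P` (both in the weak GLOBAL sense), then
`H¹_{𝒮_A} = H¹_{𝒮_E⁰}`. THE INSTANCE
(memo §1 (X): `A` with `θ : A[3] ⥲ E[3]`, good at `3`, `T_A = ∅` ⟹ `θ_* Sel₃(A) = S⁰(E)`; agreement
at `3` = Mazur–Rubin 2015 Thm. 3.1 (iv)(b), unramified off `3` = (L1), n1011 row T-URTAM; kernel
count form: `X10/SelmerCompanionsTamagawaFree`). [cite: MazurRubin2007, Def. 1.2] -/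
theorem selmerGroup_eq_residual_of_agree_of_unramified_off (𝒮A 𝒮E : QuadraticSelmerStructure 𝓆)
    (hagree : ∀ v ∈ P, ∀ c : H, loc v c ∈ 𝒮A.W v ↔ loc v c ∈ 𝒮E.W v)
    (hoff : ∀ v, v ∉ P → ∀ c : H, loc v c ∈ 𝒮A.W v ↔ loc v c ∈ Λ v) :
    𝒮A.selmerGroup = (residual 𝒮E P hP).selmerGroup := by
  rw [← residual_selmerGroup_eq_self_of_unramified_off 𝒮A hP hoff,
    selmerGroup_residual_eq_of_agree hP 𝒮A 𝒮E hagree]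

variable [∀ v, FiniteDimensional F (L v)] {S : Finset ι}

/-- **(P) The parity law for the residual structure** (Mazur–Rubin 2007 Thm. 1.4 / KMR Thm. 3.9
with `𝒮' = 𝒮⁰`): for finite `S ⊇ Σ_𝒮 ∪ P`, under the Poitou–Tate and finiteness inputs,
`dim H¹_𝒮 − dim H¹_{𝒮⁰} ≡ ∑_{v ∈ S \ P} (dim W_v − dim W_v ∩ Λ_v) (mod 2)` — the places of `P`
contribute `0` (same condition). THE INSTANCE: `dim Sel_p(E) − dim S⁰(E) ≡ ∑_{ℓ ≠ p} d_ℓ(E)`,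
`d_ℓ = dim 𝓛_ℓ/(𝓛_ℓ ∩ H¹_ur)`. [cite: MazurRubin2007, Thm. 1.4] [cite: KlagsbrunMazurRubin2013, Thm. 3.9] -/
theorem finrank_selmerGroup_sub_residual_modEq (hPS : P ⊆ S) (hS : 𝒮.places ⊆ S)
    (hfin : FiniteDimensional F (unramifiedOutside loc Λ S)) (hPT : 𝓆.IsSelfDualAt S) :
    ((finrank F 𝒮.selmerGroup : ℤ) - finrank F (residual 𝒮 P hP).selmerGroup) ≡
      ∑ v ∈ S \ P, ((finrank F (𝒮.W v) : ℤ) - finrank F ↥(𝒮.W v ⊓ Λ v)) [ZMOD 2] := by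
  have h := 𝒮.finrank_selmerGroup_sub_modEq (residual 𝒮 P hP) hS hPS hfin hPT
  rw [← Finset.sum_sdiff hPS] at h
  have hP0 : ∑ v ∈ P, ((finrank F (𝒮.W v) : ℤ) - finrank F ↥(𝒮.W v ⊓ (residual 𝒮 P hP).W v)) =
      0 :=
    Finset.sum_eq_zero fun v hv => by rw [residual_W_of_mem 𝒮 hP hv, inf_idem, sub_self]
  have hSP : ∑ v ∈ S \ P, ((finrank F (𝒮.W v) : ℤ) - finrank F ↥(𝒮.W v ⊓ (residual 𝒮 P hP).W v)) =
      ∑ v ∈ S \ P, ((finrank F (𝒮.W v) : ℤ) - finrank F ↥(𝒮.W v ⊓ Λ v)) :=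
    Finset.sum_congr rfl fun v hv => by
      rw [residual_W_of_not_mem 𝒮 hP (Finset.mem_sdiff.mp hv).2]
  rwa [hP0, add_zero, hSP] at h

/-- **(P) with LOCAL TERMS — the N2 Tamagawa-parity law, abstract form.** If off `P` the local
condition of `𝒮` is the unramified one except on a finite set `T ⊆ S \ P`, where
`dim W_v/(W_v ∩ Λ_v) = 1`, then `dim H¹_𝒮 + dim H¹_{𝒮⁰} + #T` is even, i.e.
`dim H¹_𝒮 − dim H¹_{𝒮⁰} ≡ #T (mod 2)`. THE INSTANCE (`p = 3`, `𝒮 = 𝓔`, `T = T_E = {ℓ : 3 ∣ c_ℓ(E)}`,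
local terms by (L1)/(I6)): `dim Sel₃(E) − dim S⁰(E) ≡ #T_E (mod 2)` — TRIVIAL-ROADS memo §1 (P);
census 410/410 + 229/229 pairs, 0 violations. [cite: MazurRubin2007, Thm. 1.4]
[cite: KlagsbrunMazurRubin2013, Thm. 3.9] -/
theorem even_finrank_add_finrank_residual_add_card {T : Finset ι} (hPS : P ⊆ S)
    (hS : 𝒮.places ⊆ S) (hTS : T ⊆ S \ P) (hoff : ∀ v ∈ S \ P, v ∉ T → 𝒮.W v = Λ v)
    (hT : ∀ v ∈ T, finrank F (𝒮.W v) = finrank F ↥(𝒮.W v ⊓ Λ v) + 1)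
    (hfin : FiniteDimensional F (unramifiedOutside loc Λ S)) (hPT : 𝓆.IsSelfDualAt S) :
    Even (finrank F 𝒮.selmerGroup + finrank F (residual 𝒮 P hP).selmerGroup + T.card) := by
  have h := finrank_selmerGroup_sub_residual_modEq 𝒮 hP hPS hS hfin hPT
  have hsum : ∑ v ∈ S \ P, ((finrank F (𝒮.W v) : ℤ) - finrank F ↥(𝒮.W v ⊓ Λ v)) = T.card := by
    rw [← Finset.sum_sdiff hTS]
    have h0 : ∑ v ∈ (S \ P) \ T, ((finrank F (𝒮.W v) : ℤ) - finrank F ↥(𝒮.W v ⊓ Λ v)) = 0 :=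
      Finset.sum_eq_zero fun v hv => by
        obtain ⟨hv1, hv2⟩ := Finset.mem_sdiff.mp hv
        rw [hoff v hv1 hv2, inf_idem, sub_self]
    have h1 : ∑ v ∈ T, ((finrank F (𝒮.W v) : ℤ) - finrank F ↥(𝒮.W v ⊓ Λ v)) = ∑ v ∈ T, (1 : ℤ) :=
      Finset.sum_congr rfl fun v hv => by rw [hT v hv]; push_cast; ring
    rw [h0, zero_add, h1, Finset.sum_const, nsmul_eq_mul, mul_one]
  rw [hsum, Int.modEq_iff_dvd] at h
  -- `h : 2 ∣ #T − (dim H¹_𝒮 − dim H¹_{𝒮⁰})`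
  rw [← Int.even_coe_nat, even_iff_two_dvd]
  push_cast
  have e : (finrank F 𝒮.selmerGroup : ℤ) + finrank F (residual 𝒮 P hP).selmerGroup + T.card =
      (T.card - ((finrank F 𝒮.selmerGroup : ℤ) - finrank F (residual 𝒮 P hP).selmerGroup)) +
        2 * finrank F 𝒮.selmerGroup := by ring
  rw [e]
  exact dvd_add h (dvd_mul_right 2 _)

/-- **(P), NO-GO form.** Under the hypotheses of `even_finrank_add_finrank_residual_add_card`, if
`dim H¹_𝒮 + #T` is odd then the residual Selmer group is NON-ZERO. THE INSTANCE: the 25 N2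
NOGO-parity cells (`dim Sel₃(E) + #T_E` odd — 24 rank-`0` cells with `#T_E = 1` and `96446g1`) have
`S⁰(E) ≠ 0`, hence (by the companion law (X), `X10/SelmerCompanionsTamagawaFree`) NO Tamagawa-`3`-free
good-at-`3` congruent curve is a unit curve, in Cremona's table or beyond it (memo §3).
[cite: MazurRubin2007, Thm. 1.4] -/
theorem residual_selmerGroup_ne_bot_of_odd {T : Finset ι} (hPS : P ⊆ S) (hS : 𝒮.places ⊆ S)
    (hTS : T ⊆ S \ P) (hoff : ∀ v ∈ S \ P, v ∉ T → 𝒮.W v = Λ v)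
    (hT : ∀ v ∈ T, finrank F (𝒮.W v) = finrank F ↥(𝒮.W v ⊓ Λ v) + 1)
    (hfin : FiniteDimensional F (unramifiedOutside loc Λ S)) (hPT : 𝓆.IsSelfDualAt S)
    (hodd : Odd (finrank F 𝒮.selmerGroup + T.card)) :
    (residual 𝒮 P hP).selmerGroup ≠ ⊥ := by
  intro hbot
  have h := even_finrank_add_finrank_residual_add_card 𝒮 hP hPS hS hTS hoff hT hfin hPT
  rw [hbot, finrank_bot, add_zero] at h
  exact (Nat.not_even_iff_odd.mpr hodd) h

/-- **(C2) abstract — NO UNIT COMPANION when `dim H¹_𝒮 + #T` is odd.** Under the hypotheses of the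
NO-GO form of (P) for `𝒮_E`, no Selmer structure `𝒮_A` of the same `𝓆` that agrees with `𝒮_E` on `P`
and is unramified off `P` can have `H¹_{𝒮_A} = 0` (its Selmer group is `H¹_{𝒮_E⁰} ≠ 0`). THE
INSTANCE: the 25 NOGO-parity cells of N2 have no Tamagawa-`3`-free good-at-`3` `3`-congruent UNIT
curve (memo §3; (X) + (P)). [cite: MazurRubin2007, Thm. 1.4] -/
theorem selmerGroup_ne_bot_of_agree_of_unramified_off_of_odd (hP : S₀ ⊆ P) {T : Finset ι} (hPS : P ⊆ S)
    (hS : 𝒮.places ⊆ S) (hTS : T ⊆ S \ P) (hoff : ∀ v ∈ S \ P, v ∉ T → 𝒮.W v = Λ v)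
    (hT : ∀ v ∈ T, finrank F (𝒮.W v) = finrank F ↥(𝒮.W v ⊓ Λ v) + 1)
    (hfin : FiniteDimensional F (unramifiedOutside loc Λ S)) (hPT : 𝓆.IsSelfDualAt S)
    (hodd : Odd (finrank F 𝒮.selmerGroup + T.card)) (𝒮A : QuadraticSelmerStructure 𝓆)
    (hagree : ∀ v ∈ P, ∀ c : H, loc v c ∈ 𝒮A.W v ↔ loc v c ∈ 𝒮.W v)
    (hoffA : ∀ v, v ∉ P → ∀ c : H, loc v c ∈ 𝒮A.W v ↔ loc v c ∈ Λ v) :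
    𝒮A.selmerGroup ≠ ⊥ := by
  rw [selmerGroup_eq_residual_of_agree_of_unramified_off hP 𝒮A 𝒮 hagree hoffA]
  exact residual_selmerGroup_ne_bot_of_odd 𝒮 hP hPS hS hTS hoff hT hfin hPT hodd

end Residual

/-! #### `F = 𝔽_p`: (P) in the order currency `#H¹_𝒮 = p^s` -/

section ResidualZModP

variable {p : ℕ} [Fact p.Prime] {ι : Type v} [DecidableEq ι] {H : Type w} [AddCommGroup H]
  [Module (ZMod p) H] {L : ι → Type x} [∀ v, AddCommGroup (L v)] [∀ v, Module (ZMod p) (L v)]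
  [∀ v, FiniteDimensional (ZMod p) (L v)]
  {loc : ∀ v, H →ₗ[ZMod p] L v} {Λ : ∀ v, Submodule (ZMod p) (L v)} {S₀ : Finset ι}
  {𝓆 : GlobalMetabolicStructure loc Λ S₀} (𝒮 : QuadraticSelmerStructure 𝓆) {P S T : Finset ι}
  (hP : S₀ ⊆ P)

/-- **(P) over `𝔽_p`, orders.** `#H¹_𝒮 = p^s`, `#H¹_{𝒮⁰} = p^{s₀}` ⟹ `s + s₀ + #T` is even, i.e.
`s − s₀ ≡ #T (mod 2)` (hypotheses as in `even_finrank_add_finrank_residual_add_card`). THE INSTANCE: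
`#Sel₃(E) = 3^s` (a certified `3`-descent, x10b / cc-eng-4), `#S⁰(E) = 3^{s₀}`, `T = T_E`.
[cite: MazurRubin2007, Thm. 1.4] [cite: KlagsbrunMazurRubin2013, Thm. 3.9] -/
theorem even_add_add_card_of_natCard_eq_pow (hPS : P ⊆ S) (hS : 𝒮.places ⊆ S) (hTS : T ⊆ S \ P)
    (hoff : ∀ v ∈ S \ P, v ∉ T → 𝒮.W v = Λ v)
    (hT : ∀ v ∈ T, finrank (ZMod p) (𝒮.W v) = finrank (ZMod p) ↥(𝒮.W v ⊓ Λ v) + 1)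
    (hfin : FiniteDimensional (ZMod p) (unramifiedOutside loc Λ S)) (hPT : 𝓆.IsSelfDualAt S)
    {s s₀ : ℕ} (hs : Nat.card 𝒮.selmerGroup = p ^ s)
    (hs₀ : Nat.card (residual 𝒮 P hP).selmerGroup = p ^ s₀) : Even (s + s₀ + T.card) := by
  have h := even_finrank_add_finrank_residual_add_card 𝒮 hP hPS hS hTS hoff hT hfin hPT
  haveI := hfin
  haveI : FiniteDimensional (ZMod p) 𝒮.selmerGroup :=
    Submodule.finiteDimensional_of_le (𝒮.selmerGroup_le_unramifiedOutside hS)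
  haveI : FiniteDimensional (ZMod p) (residual 𝒮 P hP).selmerGroup :=
    Submodule.finiteDimensional_of_le ((residual 𝒮 P hP).selmerGroup_le_unramifiedOutside hPS)
  rwa [finrank_eq_of_natCard_eq_pow hs, finrank_eq_of_natCard_eq_pow hs₀] at h

/-- **(P) over `𝔽_p`, NO-GO form.** `#H¹_𝒮 = p^s` with `s + #T` odd ⟹ `H¹_{𝒮⁰} ≠ 0`. THE INSTANCE:
a UNIT cell (`#Sel₃(E) = 1`, `s = 0`) with `#T_E` odd, or `96446g1` (`s = 1`, `#T_E = 2`), has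
`S⁰(E) ≠ 0` — the 25 NOGO-parity verdicts of the N2 memo §3. [cite: MazurRubin2007, Thm. 1.4] -/
theorem residual_selmerGroup_ne_bot_of_odd_natCard (hPS : P ⊆ S) (hS : 𝒮.places ⊆ S)
    (hTS : T ⊆ S \ P) (hoff : ∀ v ∈ S \ P, v ∉ T → 𝒮.W v = Λ v)
    (hT : ∀ v ∈ T, finrank (ZMod p) (𝒮.W v) = finrank (ZMod p) ↥(𝒮.W v ⊓ Λ v) + 1)
    (hfin : FiniteDimensional (ZMod p) (unramifiedOutside loc Λ S)) (hPT : 𝓆.IsSelfDualAt S)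
    {s : ℕ} (hs : Nat.card 𝒮.selmerGroup = p ^ s) (hodd : Odd (s + T.card)) :
    (residual 𝒮 P hP).selmerGroup ≠ ⊥ := by
  haveI := hfin
  haveI : FiniteDimensional (ZMod p) 𝒮.selmerGroup :=
    Submodule.finiteDimensional_of_le (𝒮.selmerGroup_le_unramifiedOutside hS)
  refine residual_selmerGroup_ne_bot_of_odd 𝒮 hP hPS hS hTS hoff hT hfin hPT ?_
  rwa [finrank_eq_of_natCard_eq_pow hs]

end ResidualZModP

/-! ### §4. (C1): two Selmer structures sharing the residual structure -/

section CongruentPair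

variable {F : Type u} [Field F] {ι : Type v} [DecidableEq ι] {H : Type w} [AddCommGroup H]
  [Module F H] {L : ι → Type x} [∀ v, AddCommGroup (L v)] [∀ v, Module F (L v)]
  [∀ v, FiniteDimensional F (L v)]
  {loc : ∀ v, H →ₗ[F] L v} {Λ : ∀ v, Submodule F (L v)} {S₀ : Finset ι}
  {𝓆 : GlobalMetabolicStructure loc Λ S₀}

/-- **(C1) Two Selmer structures agreeing on `P`.** `𝒮₁, 𝒮₂` with the same local conditions at the
places of `P`, each unramified off `P` except on `T₁` resp. `T₂` (`⊆ S \ P`) where the local term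
is `1`: then `dim H¹_{𝒮₁} + #T₁ + dim H¹_{𝒮₂} + #T₂` is even — both differ from the COMMON residual
group `H¹_{𝒮⁰}` by `#Tᵢ (mod 2)`. THE INSTANCE (two `3`-congruent curves `A, E`, both good at `3`,
transported into one `H¹(ℚ, E[3])` along `θ`; agreement at `3` = Mazur–Rubin 2015 Thm. 3.1 (iv)(b)):
`dim Sel₃(A) + #T_A ≡ dim Sel₃(E) + #T_E (mod 2)`; with `3`-parity over `ℚ`:
`w(A)(−1)^{#T_A} = w(E)(−1)^{#T_E}` — TRIVIAL-ROADS memo (C1), census 410/410 links + 229/229 twins,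
and LAW-W on > 38 000 Hesse-pencil members, 0 MISS. [cite: MazurRubin2007, Thm. 1.4]
[cite: KlagsbrunMazurRubin2013, Thm. 3.9] -/
theorem even_finrank_add_card_add_finrank_add_card (𝒮₁ 𝒮₂ : QuadraticSelmerStructure 𝓆)
    {P S T₁ T₂ : Finset ι} (hP : S₀ ⊆ P) (hPS : P ⊆ S) (hS₁ : 𝒮₁.places ⊆ S)
    (hS₂ : 𝒮₂.places ⊆ S) (hagree : ∀ v ∈ P, ∀ c : H, loc v c ∈ 𝒮₁.W v ↔ loc v c ∈ 𝒮₂.W v)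
    (hT₁S : T₁ ⊆ S \ P) (hoff₁ : ∀ v ∈ S \ P, v ∉ T₁ → 𝒮₁.W v = Λ v)
    (hT₁ : ∀ v ∈ T₁, finrank F (𝒮₁.W v) = finrank F ↥(𝒮₁.W v ⊓ Λ v) + 1)
    (hT₂S : T₂ ⊆ S \ P) (hoff₂ : ∀ v ∈ S \ P, v ∉ T₂ → 𝒮₂.W v = Λ v)
    (hT₂ : ∀ v ∈ T₂, finrank F (𝒮₂.W v) = finrank F ↥(𝒮₂.W v ⊓ Λ v) + 1)
    (hfin : FiniteDimensional F (unramifiedOutside loc Λ S)) (hPT : 𝓆.IsSelfDualAt S) :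
    Even (finrank F 𝒮₁.selmerGroup + T₁.card + finrank F 𝒮₂.selmerGroup + T₂.card) := by
  obtain ⟨a, ha⟩ := even_finrank_add_finrank_residual_add_card 𝒮₁ hP hPS hS₁ hT₁S hoff₁ hT₁ hfin hPT
  obtain ⟨b, hb⟩ := even_finrank_add_finrank_residual_add_card 𝒮₂ hP hPS hS₂ hT₂S hoff₂ hT₂ hfin hPT
  rw [selmerGroup_residual_eq_of_agree hP 𝒮₁ 𝒮₂ hagree] at ha
  exact ⟨a + b - finrank F (residual 𝒮₂ P hP).selmerGroup, by omega⟩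

end CongruentPair

end Summit.BirchSwinnertonDyer.Rank1Residual.X10.ResidualSelmerParity

end
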